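import Literature.Algebra.Lie.OrthogonalAlgebraSimpleClass
import HarnessLib

/-!
# `𝔰𝔭(V, B)` as a Mathlib `LieAlgebra.IsSimple`: for a non-degenerate alternating `B` on `V ≠ 0` with `2 ≠ 0` (Humphreys §19.2, type `C_ℓ`; Looijenga–Lunts (7.5), `ε = -1`)

Topic `Literature/Algebra/Lie` (namespace `Literature.Algebra.Lie.SymplecticAlgebraSimpleClass`).  Lane `lit-hodgefound`
(Track 2 foundations library), Layer A1, skeleton seat `lit-hodgefound-skel-1` (generation 50), row **A1-188** of
`run/shared/lean/pub/lit-hodgefound/SKELETON.md`.  Row A1-166 (`SymplecticAlgebraSimple.lean`) proves that every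
`ad(𝔰𝔭(V, B))`-stable subspace of `𝔰𝔭(V, B) = B.skewAdjointSubmodule ⊆ End(V)` is `⊥` or everything and records in its
Scope (a) that Mathlib's class `LieAlgebra.IsSimple K (skewAdjointLieSubalgebra B)` is NOT derived.  This file derives it
(row A1-187's §1 conversion + non-commutativity from the Darboux-basis matrices `E_{k,k'}`, `E_{k',k}`), together with
semisimplicity and the trivial radical.  THEOREMS ONLY; no definition, no named fact, no `sorry` (net debt `0`); no
instance, no notation.

## Sources

* [Humphreys1972] §19.2 p. 102 (the classical algebra `C_ℓ`, `ℓ ≥ 1`, is simple), §1.2 p. 3 (type `C_ℓ`).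
* [LooijengaLunts1997] Appendix Lemma (7.5), p. 28 L86–L90 (`ε = -1`: `𝔤_-(U) = 𝔞𝔲𝔱(U) = 𝔰𝔭(U)` irreducible).
* [Hall2015] Corollary 8.47 (`𝔰𝔭(n; ℂ)` is simple for `n ≥ 1`).

## Contents (all proved)

* `not_isLieAbelian_of_alt` (`[E_{k,k'}, E_{k',k}] = E_{kk} - E_{k'k'} ≠ 0` in a Darboux basis), **`isSimple_of_alt`**
  (`LieAlgebra.IsSimple K (skewAdjointLieSubalgebra B)`; `2 ≠ 0`, `V ≠ 0`, `B` alternating non-degenerate — any field),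
  `isSemisimple_of_alt`, `hasTrivialRadical_of_alt`, and the `ε = -1` phrasing `isSimple_of_forall_eq_neg`.

Nothing here is a case of the Hodge conjecture.
-/

namespace Literature.Algebra.Lie.SymplecticAlgebraSimpleClass

open Module Sum Matrix LieAlgebra

variable {K : Type*} [Field K] {V : Type*} [AddCommGroup V] [Module K V] [FiniteDimensional K V]
  {B : LinearMap.BilinForm K V}

/-- **`𝔰𝔭(V, B)` is not abelian for `V ≠ 0`**: in a Darboux basis, `E_{k,k'}` and `E_{k',k}` are in `𝔰𝔭` and
`[E_{k,k'}, E_{k',k}] = E_{kk} - E_{k'k'} ≠ 0`. [cite: Humphreys1972, §1.2 p. 3 (type C_ℓ), §19.2] -/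
theorem not_isLieAbelian_of_alt [Nontrivial V] (hBa : B.IsAlt) (hB : B.Nondegenerate) :
    ¬IsLieAbelian (skewAdjointLieSubalgebra B) := by
  classical
  obtain ⟨ι, _, _, b, h11, h22, h12, h21⟩ := Literature.LinearAlgebra.Alternating.exists_symplecticBasis hBa hB
  have hG := SymplecticAlgebraSimple.toMatrix_eq_neg_J_of_darboux b B h11 h22 h12 h21
  have hne : Nonempty (ι ⊕ ι) := b.index_nonempty
  obtain ⟨k⟩ : Nonempty ι := by
    obtain ⟨i | i⟩ := hne <;> exact ⟨i⟩
  refine OrthogonalAlgebraSimpleClass.not_isLieAbelian_of_matrices b (X := single (inl k) (inr k) (1 : K))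
    (Y := single (inr k) (inl k) (1 : K)) ?_ ?_ ?_
  · rw [hG, SymplecticAlgebraSimple.isSkewAdjoint_neg_J_iff_mem_sp]
    exact SymplecticSimple.single_inl_inr_mem_sp k
  · rw [hG, SymplecticAlgebraSimple.isSkewAdjoint_neg_J_iff_mem_sp]
    exact SymplecticSimple.single_inr_inl_mem_sp k
  · rw [single_mul_single_same, single_mul_single_same, mul_one]
    intro h
    have h' := congrArg (fun M : Matrix (ι ⊕ ι) (ι ⊕ ι) K ↦ M (inl k) (inl k)) h
    simp [Matrix.sub_apply] at h'

/-- **`𝔰𝔭(V, B)` IS A SIMPLE LIE ALGEBRA** (Mathlib's `LieAlgebra.IsSimple K (skewAdjointLieSubalgebra B)`) for every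
non-degenerate alternating `B` on a finite-dimensional `V ≠ 0` over a field with `2 ≠ 0`: type `C_ℓ`, `ℓ ≥ 1`
(`C_1 = A_1`); row A1-166's ideal-freeness plus non-commutativity — closing item (a) of that file's Scope.
[cite: Humphreys1972, §19.2, p. 102 (type C_ℓ); LooijengaLunts1997, Appendix Lemma (7.5), p. 28 L86–L90; Hall2015, Cor. 8.47] -/
theorem isSimple_of_alt [NeZero (2 : K)] [Nontrivial V] (hBa : B.IsAlt) (hB : B.Nondegenerate) :
    LieAlgebra.IsSimple K (skewAdjointLieSubalgebra B) :=
  OrthogonalAlgebraSimpleClass.isSimple_of_core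
    (fun _ hP hstab ↦ SymplecticAlgebraSimple.eq_bot_or_eq_of_forall_lie_mem hBa hB hP hstab)
    (not_isLieAbelian_of_alt hBa hB)

/-- `𝔰𝔭(V, B)` is semisimple (`V ≠ 0`, `2 ≠ 0`). [cite: Humphreys1972, §19.2, §6 Exercise 5(b) p. 30] -/
theorem isSemisimple_of_alt [NeZero (2 : K)] [Nontrivial V] (hBa : B.IsAlt) (hB : B.Nondegenerate) :
    LieAlgebra.IsSemisimple K (skewAdjointLieSubalgebra B) := by
  haveI := isSimple_of_alt hBa hB
  infer_instance

/-- `𝔰𝔭(V, B)` has trivial radical (`V ≠ 0`, `2 ≠ 0`). [cite: Humphreys1972, §19.2, §6 Exercise 5(b) p. 30] -/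
theorem hasTrivialRadical_of_alt [NeZero (2 : K)] [Nontrivial V] (hBa : B.IsAlt) (hB : B.Nondegenerate) :
    LieAlgebra.HasTrivialRadical K (skewAdjointLieSubalgebra B) := by
  haveI := isSimple_of_alt hBa hB
  infer_instance

/-- The `ε = -1` phrasing (`⟨u, u'⟩ = -⟨u', u⟩`, `GlSelfAdjointDecomposition.lean`): `𝔞𝔲𝔱(U)` of a symplectic
`U ≠ 0` is a simple Lie algebra. [cite: LooijengaLunts1997, Appendix Lemma (7.5), p. 28 L86–L90; Humphreys1972, §19.2] -/
theorem isSimple_of_forall_eq_neg [NeZero (2 : K)] [Nontrivial V] (hB : B.Nondegenerate)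
    (hε : ∀ u v : V, B u v = -B v u) : LieAlgebra.IsSimple K (skewAdjointLieSubalgebra B) := by
  refine isSimple_of_alt (fun u ↦ ?_) hB
  have h := hε u u
  have h2 : (2 : K) * B u u = 0 := by linear_combination h
  exact (mul_eq_zero.1 h2).resolve_left (NeZero.ne 2)

end Literature.Algebra.Lie.SymplecticAlgebraSimpleClass
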